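import Mathlib
import Summits.Ventures.PercRepro2.Defs
import Summits.Ventures.PercRepro2.Independence
import Summits.Ventures.PercRepro2.Harris
import Summits.Ventures.PercRepro2.Graph
import Summits.Ventures.PercRepro2.Exploration
import Summits.Ventures.PercRepro2.Events
import Summits.Ventures.PercRepro2.Induced
import Summits.Ventures.PercRepro2.HCov
import Summits.Ventures.PercRepro2.HubModel
import Summits.Ventures.PercRepro2.HubModel3
import Summits.Ventures.PercRepro2.HubLaw3
import Summits.Ventures.PercRepro2.HubBundle3
import Summits.Ventures.PercRepro2.HubEvents3

/-!
# The a₃-hub: Bernstein regrouping, hub events, and the masses as Bernstein-1 forms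
(blind cell PercRepro2, mine-2 g17; MINE2-A3FIRST.md §3, §8 — typer-1's `HubBernstein` / `HubConn`
with the roles of `a₃` and the roots exchanged; towards «(HCOV) on R₃» in the kernel)

* Generic Bernstein algebra over an index type `ι` of bundles (here `Fin 4`, the four a₃ bundles):
  a **Bernstein-1 form** in the weights `q` is `bform q f = Σ_w weight q w · f w`; three degree-1
  basis elements multiply to the degree-3 basis element `bern q (prof w₁ w₂ w₃)`
  (`weight_mul_mul`), so `bform q f · bform q g · bform q h = Σ_k bern q k · coef3 f g h k`
  (`bform_mul_mul`), and `bern q k ≥ 0` on `[0, 1]^ι` (`bern_nonneg`).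
* **Hub events** `toEvent3 ends μ Ψ = {ω | Ψ (W ω) (Π ω)}` for a Boolean function `Ψ : HubEvt3` of
  the a₃-bundle state `W = a3State` and the inner pattern `Π = innerPat3`; closed under `∩`, `∪`,
  complement; every connection event between marks is one in the class R₃
  (`connEvent_eq_toEvent3`, through the decidable model reachability `reachOf3`).
* **Every hub mass is a Bernstein-1 form** in the four effective bundle weights `bundleWeight3`,
  with the inner masses `m_π = P(Π = π)` in its table (`prob_toEvent3_eq_bform`): the a₃-hub law
  `prob_hubEvent3` with the bundle law `prob_a3State_eq_prod_pow` of `HubBundle3.lean`.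
-/

namespace Summit.Ventures.PercRepro2.Hub3

open Hub

section Profile

variable {ι : Type*} {R : Type*} [CommRing R]

/-- The profile of a triple of states: `kᵢ = w₁ᵢ + w₂ᵢ + w₃ᵢ`. -/
def prof (w₁ w₂ w₃ : ι → Bool) : ι → Fin 4 := fun i =>
  ⟨(w₁ i).toNat + (w₂ i).toNat + (w₃ i).toNat, by
    have := Bool.toNat_le (w₁ i)
    have := Bool.toNat_le (w₂ i)
    have := Bool.toNat_le (w₃ i)
    omega⟩

/-- The value of the profile. -/
lemma prof_apply (w₁ w₂ w₃ : ι → Bool) (i : ι) :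
    (prof w₁ w₂ w₃ i : ℕ) = (w₁ i).toNat + (w₂ i).toNat + (w₃ i).toNat := rfl

/-- Three Bernoulli factors of one weight multiply to a degree-3 Bernstein factor. -/
lemma edgeFactor_mul_mul (x : R) (b₁ b₂ b₃ : Bool) :
    edgeFactor x b₁ * edgeFactor x b₂ * edgeFactor x b₃ =
      x ^ (b₁.toNat + b₂.toNat + b₃.toNat) * (1 - x) ^ (3 - (b₁.toNat + b₂.toNat + b₃.toNat)) := by
  cases b₁ <;> cases b₂ <;> cases b₃ <;> simp [edgeFactor] <;> ring

/-- A product of three sums is a triple sum. -/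
lemma sum_mul_sum_mul_sum {α β γ : Type*} [Fintype α] [Fintype β] [Fintype γ]
    (f : α → R) (g : β → R) (h : γ → R) :
    (∑ a, f a) * (∑ b, g b) * (∑ c, h c) = ∑ a, ∑ b, ∑ c, f a * g b * h c := by
  rw [Finset.sum_mul_sum]
  simp only [Finset.sum_mul]
  simp only [Finset.mul_sum]

end Profile

section Bernstein

variable {ι : Type*} [Fintype ι] {R : Type*} [CommRing R]

/-- The degree-3 Bernstein basis polynomial of the type vector `k`:
`∏ᵢ qᵢ^{kᵢ} (1 - qᵢ)^{3 - kᵢ}`. -/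
def bern (q : ι → R) (k : ι → Fin 4) : R :=
  ∏ i, q i ^ (k i : ℕ) * (1 - q i) ^ (3 - (k i : ℕ))

/-- **Three degree-1 basis elements multiply to a degree-3 basis element.** -/
theorem weight_mul_mul (q : ι → R) (w₁ w₂ w₃ : ι → Bool) :
    weight q w₁ * weight q w₂ * weight q w₃ = bern q (prof w₁ w₂ w₃) := by
  simp only [weight, bern, prof_apply, ← Finset.prod_mul_distrib]
  exact Finset.prod_congr rfl fun i _ => edgeFactor_mul_mul _ _ _ _

variable [DecidableEq ι]

/-- A Bernstein-1 form: `Σ_w weight q w · f w`. -/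
def bform (q : ι → R) (f : (ι → Bool) → R) : R := ∑ w, weight q w * f w

/-- Bernstein-1 forms are additive in the table. -/
lemma bform_add (q : ι → R) (f g : (ι → Bool) → R) : bform q (f + g) = bform q f + bform q g := by
  simp only [bform, Pi.add_apply, mul_add, Finset.sum_add_distrib]

/-- Bernstein-1 forms are subtractive in the table. -/
lemma bform_sub (q : ι → R) (f g : (ι → Bool) → R) : bform q (f - g) = bform q f - bform q g := by
  simp only [bform, Pi.sub_apply, mul_sub, Finset.sum_sub_distrib]

/-- The degree-3 Bernstein coefficient of a product of three forms:
`Σ_{prof w₁ w₂ w₃ = k} f w₁ · g w₂ · h w₃`. -/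
def coef3 (f g h : (ι → Bool) → R) (k : ι → Fin 4) : R :=
  ∑ t : (ι → Bool) × (ι → Bool) × (ι → Bool) with prof t.1 t.2.1 t.2.2 = k,
    f t.1 * g t.2.1 * h t.2.2

/-- A product of three Bernstein-1 forms as a triple sum. -/
lemma bform_mul_mul_eq_sum (q : ι → R) (f g h : (ι → Bool) → R) :
    bform q f * bform q g * bform q h =
      ∑ t : (ι → Bool) × (ι → Bool) × (ι → Bool),
        weight q t.1 * weight q t.2.1 * weight q t.2.2 * (f t.1 * g t.2.1 * h t.2.2) := by
  unfold bform
  rw [sum_mul_sum_mul_sum]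
  simp only [Fintype.sum_prod_type]
  refine Finset.sum_congr rfl fun a _ => Finset.sum_congr rfl fun b _ =>
    Finset.sum_congr rfl fun c _ => ?_
  ring

/-- **The Bernstein regrouping**: a product of three Bernstein-1 forms is a degree-3 Bernstein
form with coefficients `coef3`. -/
theorem bform_mul_mul (q : ι → R) (f g h : (ι → Bool) → R) :
    bform q f * bform q g * bform q h = ∑ k, bern q k * coef3 f g h k := by
  rw [bform_mul_mul_eq_sum]
  unfold coef3
  simp only [Finset.mul_sum]
  rw [← Finset.sum_fiberwise Finset.univ
    (fun t : (ι → Bool) × (ι → Bool) × (ι → Bool) => prof t.1 t.2.1 t.2.2)]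
  refine Finset.sum_congr rfl fun k _ => Finset.sum_congr rfl fun t ht => ?_
  rw [Finset.mem_filter] at ht
  rw [← ht.2, weight_mul_mul]

end Bernstein

section Nonneg

variable {ι : Type*} [Fintype ι] {R : Type*} [CommRing R] [PartialOrder R] [IsOrderedRing R]

/-- The Bernstein basis is nonnegative on `[0, 1]^ι`. -/
theorem bern_nonneg {q : ι → R} (hq : ∀ i, 0 ≤ q i ∧ q i ≤ 1) (k : ι → Fin 4) :
    0 ≤ bern q k := by
  unfold bern
  refine Finset.prod_nonneg fun i _ => mul_nonneg (pow_nonneg (hq i).1 _) (pow_nonneg ?_ _)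
  exact sub_nonneg.2 (hq i).2

end Nonneg

/-! ## Hub events of the a₃-hub -/

/-- A hub event of the a₃-hub: a Boolean function of the state pair `(w, π)`. -/
abbrev HubEvt3 := (Fin 4 → Bool) → (Fin 6 → Bool) → Bool

variable {V : Type*} {E : Type*}

section Events

variable (ends : E → Sym2 V) (μ : Mark → V)

/-- The event of `ω` determined by a hub event: `{ω | Ψ (W ω) (Π ω)}`. -/
def toEvent3 (Ψ : HubEvt3) : Set (Config E) :=
  {ω | Ψ (a3State ends μ ω) (innerPat3 ends μ ω) = true}

/-- Membership in `toEvent3`. -/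
lemma mem_toEvent3 {Ψ : HubEvt3} {ω : Config E} :
    ω ∈ toEvent3 ends μ Ψ ↔ Ψ (a3State ends μ ω) (innerPat3 ends μ ω) = true := Iff.rfl

/-- Conjunction of hub events is intersection. -/
lemma toEvent3_and (Ψ₁ Ψ₂ : HubEvt3) :
    toEvent3 ends μ (fun w π => Ψ₁ w π && Ψ₂ w π) = toEvent3 ends μ Ψ₁ ∩ toEvent3 ends μ Ψ₂ := by
  ext ω
  simp only [mem_toEvent3, Set.mem_inter_iff, Bool.and_eq_true]

/-- Disjunction of hub events is union. -/
lemma toEvent3_or (Ψ₁ Ψ₂ : HubEvt3) :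
    toEvent3 ends μ (fun w π => Ψ₁ w π || Ψ₂ w π) = toEvent3 ends μ Ψ₁ ∪ toEvent3 ends μ Ψ₂ := by
  ext ω
  simp only [mem_toEvent3, Set.mem_union, Bool.or_eq_true]

/-- Negation of a hub event is the complement. -/
lemma toEvent3_not (Ψ : HubEvt3) :
    toEvent3 ends μ (fun w π => !Ψ w π) = (toEvent3 ends μ Ψ)ᶜ := by
  ext ω
  simp only [mem_toEvent3, Set.mem_compl_iff, Bool.not_eq_true', Bool.not_eq_true]

end Events

section Reach

variable (w : Fin 4 → Bool) (π : Fin 6 → Bool)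

/-- The adjacency table is symmetric. -/
lemma adjOf3_comm (u v : Mark) : adjOf3 w π u v = adjOf3 w π v u := by
  cases u <;> cases v <;> rfl

/-- The adjacency table vanishes on the diagonal. -/
lemma adjOf3_self (u : Mark) : adjOf3 w π u u = false := by
  cases u <;> rfl

/-- Adjacent marks in the table are distinct. -/
lemma ne_of_adjOf3 {u v : Mark} (h : adjOf3 w π u v = true) : u ≠ v := by
  rintro rfl
  rw [adjOf3_self] at h
  exact Bool.false_ne_true h

/-- The table gives the model-graph adjacency. -/
lemma modelGraphOf3_adj_iff {u v : Mark} :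
    (modelGraphOf3 w π).Adj u v ↔ adjOf3 w π u v = true := by
  rw [modelGraphOf3, SimpleGraph.fromRel_adj, adjOf3_comm w π v u, or_self]
  exact ⟨fun h => h.2, fun h => ⟨ne_of_adjOf3 w π h, h⟩⟩

/-- One closure step: add the model-neighbours of `S`. -/
def stepOf3 (S : Finset Mark) : Finset Mark :=
  S ∪ Finset.univ.filter fun v => ∃ u ∈ S, adjOf3 w π u v = true

/-- The marks reached from `u` in at most `n` steps. -/
def reachSet3 (u : Mark) : ℕ → Finset Mark
  | 0 => {u}
  | n + 1 => stepOf3 w π (reachSet3 u n)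

/-- **Computable reachability** in the model graph of a state pair: four closure steps suffice
for five marks (kernel-computable by `decide`, no walk enumeration). -/
def reachOf3 (u v : Mark) : Bool := decide (v ∈ reachSet3 w π u 4)

/-- The closure steps are increasing. -/
lemma reachSet3_subset_succ (u : Mark) (n : ℕ) : reachSet3 w π u n ⊆ reachSet3 w π u (n + 1) :=
  Finset.subset_union_left

/-- The closure steps are increasing (general form). -/
lemma reachSet3_subset_of_le (u : Mark) {n m : ℕ} (h : n ≤ m) :
    reachSet3 w π u n ⊆ reachSet3 w π u m := by
  induction h with
  | refl => exact subset_rfl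
  | step _ ih => exact ih.trans (reachSet3_subset_succ w π u _)

/-- A neighbour of a reached mark is reached one step later. -/
lemma mem_reachSet3_succ_of_adj {u x y : Mark} {n : ℕ} (hx : x ∈ reachSet3 w π u n)
    (hxy : adjOf3 w π x y = true) : y ∈ reachSet3 w π u (n + 1) := by
  refine Finset.mem_union_right _ ?_
  rw [Finset.mem_filter]
  exact ⟨Finset.mem_univ _, x, hx, hxy⟩

/-- Soundness: a reached mark is reachable in the model graph. -/
lemma reachable_of_mem_reachSet3 {u v : Mark} : ∀ {n : ℕ}, v ∈ reachSet3 w π u n →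
    (modelGraphOf3 w π).Reachable u v
  | 0, h => by
    rw [reachSet3, Finset.mem_singleton] at h
    subst h
    exact SimpleGraph.Reachable.refl _
  | n + 1, h => by
    rw [reachSet3, stepOf3, Finset.mem_union, Finset.mem_filter] at h
    rcases h with h | ⟨_, x, hx, hxv⟩
    · exact reachable_of_mem_reachSet3 h
    · exact (reachable_of_mem_reachSet3 hx).trans
        ((modelGraphOf3_adj_iff w π).2 hxv).reachable

/-- Completeness along a walk: a walk of length `l` from a reached mark ends in a mark reached
`l` steps later. -/
lemma mem_reachSet3_add_length {u x v : Mark} (p : (modelGraphOf3 w π).Walk x v) :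
    ∀ {n : ℕ}, x ∈ reachSet3 w π u n → v ∈ reachSet3 w π u (n + p.length) := by
  induction p with
  | nil => intro n hx; simpa using hx
  | cons hadj _ ih =>
    intro n hx
    have := ih (mem_reachSet3_succ_of_adj w π hx ((modelGraphOf3_adj_iff w π).1 hadj))
    rw [SimpleGraph.Walk.length_cons, ← Nat.add_assoc]
    rwa [Nat.add_right_comm] at this

/-- The five marks. -/
lemma card_mark3 : Fintype.card Mark = 5 := by decide

/-- **Computable reachability is reachability**: `reachOf3 w π u v = true ↔ u` reaches `v` in the
model graph. -/
theorem reachOf3_iff (u v : Mark) :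
    reachOf3 w π u v = true ↔ (modelGraphOf3 w π).Reachable u v := by
  rw [reachOf3, decide_eq_true_iff]
  refine ⟨reachable_of_mem_reachSet3 w π, fun h => ?_⟩
  refine h.elim_path fun p => ?_
  have hlen : p.1.length ≤ 4 := by
    have := p.2.length_lt
    rw [card_mark3] at this
    omega
  have hmem : v ∈ reachSet3 w π u (0 + p.1.length) :=
    mem_reachSet3_add_length w π p.1 (by simp [reachSet3])
  exact reachSet3_subset_of_le w π u (by omega) hmem

end Reach

section Conn

variable {ends : E → Sym2 V} {μ : Mark → V}

/-- **Connection events between marks are hub events** (class R₃, injective marking). -/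
theorem connEvent_eq_toEvent3 (hinj : Function.Injective μ) (hR : ClassR3 ends μ) (u v : Mark) :
    connEvent ends (μ u) (μ v) = toEvent3 ends μ (fun w π => reachOf3 w π u v) := by
  ext ω
  rw [mem_connEvent, mem_toEvent3, reachOf3_iff, conn_iff_reachable_state3 hinj hR]

variable [Fintype E] [DecidableEq E] {R : Type*} [CommRing R]

/-- **The a₃-hub law for hub events**:
`P(toEvent3 Ψ) = Σ_w Σ_π 1[Ψ w π] · P(W = w) · P(Π = π)`. -/
theorem prob_toEvent3 (p : E → R) (Ψ : HubEvt3) :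
    prob p (toEvent3 ends μ Ψ) = ∑ w, ∑ π, if Ψ w π = true then
      prob p {ω | a3State ends μ ω = w} * prob p {ω | innerPat3 ends μ ω = π} else 0 :=
  prob_hubEvent3 p (fun w π => Ψ w π = true)

/-- **The a₃-bundle state is a four-edge percolation**: `P(W = w) = weight q w` with the effective
bundle weights `q = bundleWeight3`. -/
theorem prob_a3State_eq_weight [DecidableEq V] (hinj : Function.Injective μ) (p : E → R)
    (w : Fin 4 → Bool) :
    prob p {ω | a3State ends μ ω = w} = weight (bundleWeight3 p ends μ) w := by
  rw [prob_a3State_eq_prod_pow p ends hinj w, weight_apply]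
  refine Finset.prod_congr rfl fun i _ => ?_
  cases w i <;> simp [edgeFactor]

/-- The coefficient table of a hub event with inner masses `m`: `f_Ψ(w) = Σ_π 1[Ψ w π] m_π`. -/
def tableOf3 (Ψ : HubEvt3) (m : (Fin 6 → Bool) → R) : (Fin 4 → Bool) → R :=
  fun w => ∑ π, if Ψ w π then m π else 0

/-- **Every hub mass is a Bernstein-1 form** in the bundle weights, with the inner masses
`m_π = P(Π = π)` in its table: `P(toEvent3 Ψ) = bform q (tableOf3 Ψ m)`. -/
theorem prob_toEvent3_eq_bform [DecidableEq V] (hinj : Function.Injective μ) (p : E → R)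
    (Ψ : HubEvt3) (m : (Fin 6 → Bool) → R)
    (hm : ∀ π, prob p {ω | innerPat3 ends μ ω = π} = m π) :
    prob p (toEvent3 ends μ Ψ) = bform (bundleWeight3 p ends μ) (tableOf3 Ψ m) := by
  classical
  rw [prob_toEvent3 p Ψ]
  simp only [hm, prob_a3State_eq_weight hinj p]
  unfold bform tableOf3
  simp only [Finset.mul_sum]
  refine Finset.sum_congr rfl fun w _ => Finset.sum_congr rfl fun π _ => ?_
  split_ifs <;> simp

end Conn

end Summit.Ventures.PercRepro2.Hub3
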